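import Summits.PneNP.PneNP.Theorems.ConvexRankGatesConvexGateBlindExactLiftingAnchoredMixedKernel
import Summits.PneNP.PneNP.Theorems.ConvexRankGatesConvexGateBlindExactLiftingOneSided

/-!
# `ExactLifting`: the mixed junta × anchor cell is EXCLUDED (d-juntas, isoperimetric XOR instances)

Support file for crux `ConvexGateBlind` (stmt-PneNP-10680), line `xor-door-perfect-completeness`, open stub
`stub_exactLifting` (prover seat 0, session 18; third of three files: `…AnchoredMixedCore` ⟵ `…AnchoredMixedKernel` ⟵ this;
memo ANALYSIS9 §3).

THEOREM (`no_mixedJunta_anchor_core_of`; on the Index-lift `no_mixedJunta_anchor_lift[_of]`, registered). Let the XOR instance `A : V → Finset (Fin m)`, `c : V → 𝔽₂` satisfy Grigoriev's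
isoperimetric hypotheses at scale `1` and degree `d` (`IsoHyp A 1 d`: every set of equations whose boundary has `≤ d`
variables is a singleton or a co-singleton; connected), with equations of `≤ d` variables, pairwise distinct, every
variable in an even number of equations, ODD total charge, every even syndrome realisable, and `#V ≥ 6` witnessed by a
vertex set `x` with `3 ≤ #x ≤ #V − 3` (Tseitin on a cubic 3-edge-connected graph whose 3-edge cuts are stars, `d = 3`,
is the case of the crux line). Then the XOR core admits NO identity
`violCount(z + y) = ∑_l T_l(z,y) + α(z) β(y)` with `T_l ≥ 0` each a `d`-junta of `z` OR of `y` and `α, β > 0` — of any size.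
With p104687 (one-sided terms, any anchor) and `no_oneSidedJunta_shift_of` (mixed terms, isotropic anchor) this closes
the junta × anchor table: on the core, no junta structure of degree `d` coexists with ANY positive anchor.

Proof (ANALYSIS9 §3, direct form). (1) `anchor_coeff_mul_eq_zero`: pairing the identity with `f̂(U) ⊗ f̂(U')` for `#U, #U' > d`
kills the count and every one-sided junta term, so `α̂(U) β̂(U') = 0`: `β` (or, transposing, `α`) has degree `≤ d`.
(2) For `γ > 0` of degree `≤ d` the DETERMINED PART `γ̄(z) = ∑_{S det} γ̂(S) χ_S(z)` is positive (`detPart_pos`): it is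
the average of `γ` over the coset `z + K` of the kernel `K = {k : all equations of the homogeneous system hold}` — the
one place where linear-algebra duality enters (`exists_bd_eq_of_ker`: a parity vanishing on `K` is a boundary, via
`mem_span_of_iInf_ker_le_ker`; then isoperimetry makes it `∅` or an equation). (3) FLIP (`IsoHyp.detPart_flip`): for the
point `q_v` realising the charge vector flipped at `v`, `γ̄(z + q_v) = γ̌(z) − 2τ_v(z)` with `γ̌(z) = Ẽ[γ(z+·)]` and
`τ_v(z) = sgn(c v) γ̂(A v) χ_{A v}(z)`; so `γ̌(z) < 0` forces `τ_v(z) < 0` for every `v`, whence any two such `z` agree on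
every `χ_{A v}` (`IsoHyp.bad_agree`) and on `χ_{∂x}` (`chi_bd`). (4) Choose the parity class of `D = ∂x` avoiding the bad points; on it
`γ̌ ≥ 0`, and `∑_z 𝟙_D(z) γ̌(z) = 2^{m−1} γ̂(∅) > 0` gives a strict point (`IsoHyp.exists_good_class`). (5) `D` is far
(`IsoHyp.far_bd`), so `mixed_anchor_core_contra_of` (previous file) finishes.
-/

set_option linter.dupNamespace false -- `Summit.PneNP.PneNP.…`: summit = sub-problem (D-0017)

namespace Summit.PneNP.PneNP.Theorems.XorDoor.PC

open Finset

noncomputable section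

variable {m : ℕ} {V : Type} [Fintype V] [DecidableEq V]

/-! ## §4 A good parity class of a far boundary -/

/-- **Boundaries of middle-sized vertex sets are far**: if `3 ≤ #x` and `#x + 3 ≤ #V` then `∂x ∆ S` is never
determined for `#S ≤ d`. -/
theorem IsoHyp.far_bd {A : V → Finset (Fin m)} {d : ℕ} (h : IsoHyp A 1 d) (x : Finset V) (hx : 3 ≤ x.card)
    (hx' : x.card + 3 ≤ Fintype.card V) :
    ∀ S : Finset (Fin m), S.card ≤ d → ¬ Det A 1 (symmDiff (bd A x) S) := by
  classical
  rintro S hS ⟨T, hT, hTS⟩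
  -- `S = ∂(x ∆ T)`
  have hS' : bd A (symmDiff x T) = S := by
    rw [bd_symmDiff, hTS]
    ext i
    simp only [mem_symmDiff]
    tauto
  have hcard1 : x.card ≤ (symmDiff x T).card + T.card := by
    calc x.card ≤ (symmDiff x T ∪ T).card := card_le_card fun w hw => by
            by_cases hwT : w ∈ T
            · exact mem_union_right _ hwT
            · exact mem_union_left _ (mem_symmDiff.mpr (Or.inl ⟨hw, hwT⟩))
      _ ≤ (symmDiff x T).card + T.card := card_union_le _ _
  have hcard2 : (symmDiff x T).card ≤ x.card + T.card :=
    (card_le_card (symmDiff_subset_union (s := x) (t := T))).trans (card_union_le _ _)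
  rcases h.iso (symmDiff x T) (by rw [hS']; exact hS) with hsmall | hbig
  · omega
  · omega

/-- **A good parity class exists.** For `γ > 0` of degree `≤ d` and a far set `D = ∂x`, some parity class of `D`
avoids every point with `Ẽ[γ(z+·)] < 0` and contains a point with `Ẽ[γ(z+·)] > 0`. -/
theorem IsoHyp.exists_good_class {A : V → Finset (Fin m)} {d : ℕ} (h : IsoHyp A 1 d) (hdeg : bd A univ = ∅)
    (c : V → ZMod 2) (hA : ∀ v, (A v).card ≤ d) (hinj : Function.Injective A) (hodd : ∑ v, c v = 1)
    (hsurj : ∀ σ : V → ZMod 2, ∑ v, σ v = 0 → ∃ q : Fin m → ZMod 2, ∀ v, ∑ i ∈ A v, q i = σ v)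
    (x : Finset V) (hx : 3 ≤ x.card) (hx' : x.card + 3 ≤ Fintype.card V)
    {γ : (Fin m → ZMod 2) → ℝ} (hγ : ∀ S : Finset (Fin m), d < S.card → coeff γ S = 0) (hpos : ∀ u, 0 < γ u) :
    ∃ c₀ : ZMod 2, (∀ z : Fin m → ZMod 2, (∑ i ∈ bd A x, z i) = c₀ → 0 ≤ func A c 1 (fun u => γ (z + u))) ∧
      ∃ z : Fin m → ZMod 2, (∑ i ∈ bd A x, z i) = c₀ ∧ 0 < func A c 1 (fun u => γ (z + u)) := by
  classical
  have hfar := h.far_bd x hx hx'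
  set D := bd A x with hD
  -- mass of `γ̌` on a parity class: `∑_z 𝟙_D(z) γ̌(z) = 2^{m-1} γ̂(∅) > 0` for either class
  have hmass : ∀ c₀ : ZMod 2, 0 < ∑ z, pind D c₀ z * func A c 1 (fun u => γ (z + u)) := by
    intro c₀
    have hDne : D ≠ ∅ := fun hDe =>
      hfar ∅ (by simp) (by rw [hDe, symmDiff_self, Finset.bot_eq_empty]; exact det_empty A 1)
    have hval : ∑ z, pind D c₀ z * func A c 1 (fun u => γ (z + u)) = 2 ^ m / 2 * coeff γ ∅ := by
      simp_rw [func_translate_eq, Finset.mul_sum]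
      rw [Finset.sum_comm]
      have hS : ∀ S : Finset (Fin m), ∑ z, pind D c₀ z * (e A c 1 S * (coeff γ S * chi S z)) =
          e A c 1 S * coeff γ S * (((if S = ∅ then (2 : ℝ) ^ m else 0) +
            sgn c₀ * (if symmDiff D S = ∅ then (2 : ℝ) ^ m else 0)) / 2) := by
        intro S
        have h1 : ∀ z, pind D c₀ z * (e A c 1 S * (coeff γ S * chi S z)) =
            e A c 1 S * coeff γ S * ((chi S z + sgn c₀ * chi (symmDiff D S) z) / 2) := fun z => by
          rw [pind_eq, ← chi_mul_chi]; ring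
        simp_rw [h1]
        rw [← Finset.mul_sum]
        congr 1
        rw [← Finset.sum_div]
        congr 1
        rw [Finset.sum_add_distrib, ← Finset.mul_sum, sum_chi, sum_chi]
      simp_rw [hS]
      rw [Finset.sum_eq_single ∅]
      · rw [if_pos rfl, if_neg (by simpa using hDne), h.e_empty]; ring
      · intro S _ hS0
        rw [if_neg hS0]
        by_cases hdet : Det A 1 S
        · have hSd : S.card ≤ d := by
            obtain ⟨T, hT, rfl⟩ := hdet
            rcases Nat.le_one_iff_eq_zero_or_eq_one.mp hT with h0 | h1
            · rw [Finset.card_eq_zero.mp h0, bd_empty]; simp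
            · obtain ⟨w, rfl⟩ := Finset.card_eq_one.mp h1
              rw [bd_singleton]; exact hA w
          rw [if_neg]
          · ring
          · intro hDS
            exact hfar S hSd (by rw [hDS]; exact det_empty A 1)
        · rw [e_eq_zero hdet]; ring
      · intro h0; exact absurd (mem_univ ∅) h0
    rw [hval]
    have hc : 0 < coeff γ ∅ := by
      unfold coeff
      exact div_pos (Finset.sum_pos (fun y _ => by rw [chi_empty, mul_one]; exact hpos y) univ_nonempty)
        (by positivity)
    positivity
  -- pick the class: avoid a bad point if there is one
  by_cases hbad : ∃ z₀ : Fin m → ZMod 2, func A c 1 (fun u => γ (z₀ + u)) < 0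
  · obtain ⟨z₀, hz₀⟩ := hbad
    refine ⟨(∑ i ∈ D, z₀ i) + 1, fun z hz => ?_, ?_⟩
    · by_contra hneg
      push Not at hneg
      -- `z` and `z₀` are both bad, so they agree on `χ_D`, contradicting the class choice
      have hchi : chi D z = chi D z₀ := by
        rw [hD, chi_bd, chi_bd]
        exact Finset.prod_congr rfl fun v _ => h.bad_agree hdeg c hinj hodd hsurj hγ hpos hneg hz₀ v
      rw [chi_eq_sgn_sum, chi_eq_sgn_sum, sgn_eq_sgn_iff, hz] at hchi
      have h10 : (∑ i ∈ D, z₀ i) + 1 = (∑ i ∈ D, z₀ i) + 0 := by rw [add_zero]; exact hchi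
      exact one_ne_zero (add_left_cancel h10)
    · have hlt : ∑ _z : Fin m → ZMod 2, (0 : ℝ) <
          ∑ z, pind D ((∑ i ∈ D, z₀ i) + 1) z * func A c 1 (fun u => γ (z + u)) := by
        rw [Finset.sum_const_zero]; exact hmass _
      obtain ⟨z, _, hz⟩ := Finset.exists_lt_of_sum_lt hlt
      rcases pind_eq_zero_or_one D ((∑ i ∈ D, z₀ i) + 1) z with h0 | h1
      · rw [h0, zero_mul] at hz; exact absurd hz (lt_irrefl 0)
      · refine ⟨z, ?_, by rw [h1, one_mul] at hz; exact hz⟩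
        by_contra hne; simp [pind, hne] at h1
  · push Not at hbad
    refine ⟨0, fun z _ => hbad z, ?_⟩
    have hlt : ∑ _z : Fin m → ZMod 2, (0 : ℝ) < ∑ z, pind D 0 z * func A c 1 (fun u => γ (z + u)) := by
      rw [Finset.sum_const_zero]; exact hmass _
    obtain ⟨z, _, hz⟩ := Finset.exists_lt_of_sum_lt hlt
    rcases pind_eq_zero_or_one D 0 z with h0 | h1
    · rw [h0, zero_mul] at hz; exact absurd hz (lt_irrefl 0)
    · refine ⟨z, ?_, by rw [h1, one_mul] at hz; exact hz⟩
      by_contra hne; simp [pind, hne] at h1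

/-! ## §5 The anchor is low-degree on one side, and the theorem -/

omit [DecidableEq V] in
/-- **(E1) on the core.** In a mixed one-sided `d`-junta + anchor identity for the count (equations of `≤ d` variables),
`α̂(U) · β̂(U') = 0` whenever `#U, #U' > d`. -/
theorem anchor_coeff_mul_eq_zero {A : V → Finset (Fin m)} (c : V → ZMod 2) {d : ℕ} (hA : ∀ v, (A v).card ≤ d)
    {L : Type} [Fintype L] (S : L → Finset (Fin m)) (hS : ∀ l, (S l).card ≤ d)
    (T : L → (Fin m → ZMod 2) → (Fin m → ZMod 2) → ℝ)
    (hT : ∀ l, (∀ (y : Fin m → ZMod 2) (z z' : Fin m → ZMod 2),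
                  (∀ i ∈ S l, z i = z' i) → T l z y = T l z' y) ∨
               (∀ (z : Fin m → ZMod 2) (y y' : Fin m → ZMod 2),
                  (∀ i ∈ S l, y i = y' i) → T l z y = T l z y'))
    (α β : (Fin m → ZMod 2) → ℝ)
    (hid : ∀ z y : Fin m → ZMod 2, violCount A c (z + y) = ∑ l, T l z y + α z * β y)
    {U U' : Finset (Fin m)} (hU : d < U.card) (hU' : d < U'.card) : coeff α U * coeff β U' = 0 := by
  classical
  -- inner functional `f̂(U')` in `y`, outer functional `f̂(U)` in `z`
  have hinner : ∀ z, coeff (fun y => violCount A c (z + y)) U' =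
      ∑ l, coeff (fun y => T l z y) U' + α z * coeff β U' := by
    intro z
    have hfun : (fun y => violCount A c (z + y)) = ∑ l, (fun y => T l z y) + α z • β := by
      funext y
      simp only [Finset.sum_apply, Pi.add_apply, Pi.smul_apply, smul_eq_mul]
      exact hid z y
    rw [hfun, ← coeffLin_apply, map_add, map_sum, map_smul]
    simp only [coeffLin_apply, smul_eq_mul]
  have hleft : ∀ z, coeff (fun y => violCount A c (z + y)) U' = 0 := fun z =>
    lowDeg_translate (lowDeg_violCount c hA) z U' hU'
  -- the function `z ↦ ∑_l (T_l(z,·))^(U')` is a sum of `d`-juntas of `z` (column-junta terms contribute `0`)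
  have hcol : ∀ l z, (∀ (z : Fin m → ZMod 2) (y y' : Fin m → ZMod 2), (∀ i ∈ S l, y i = y' i) →
      T l z y = T l z y') → coeff (fun y => T l z y) U' = 0 := fun l z hc =>
    lowDeg_of_junta (hS l) (hc z) U' hU'
  have hz : ∀ z, α z * coeff β U' = -∑ l, coeff (fun y => T l z y) U' := fun z => by
    have := hinner z; rw [hleft z] at this; linarith
  -- apply `f̂(U)` in `z`
  have hfz : (fun z => α z * coeff β U') = coeff β U' • α := by
    funext z; simp only [Pi.smul_apply, smul_eq_mul]; ring
  have h1 : coeff (fun z => α z * coeff β U') U = coeff β U' * coeff α U := by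
    rw [hfz, ← coeffLin_apply, map_smul, coeffLin_apply, smul_eq_mul]
  have h2 : coeff (fun z => α z * coeff β U') U = 0 := by
    have hfun : (fun z => α z * coeff β U') = -∑ l, fun z => coeff (fun y => T l z y) U' := by
      funext z
      simp only [Pi.neg_apply, Finset.sum_apply]
      exact hz z
    rw [hfun, ← coeffLin_apply, map_neg, map_sum, neg_eq_zero]
    refine Finset.sum_eq_zero fun l _ => ?_
    rw [coeffLin_apply]
    rcases hT l with hrow | hc
    · -- row-junta: `z ↦ (T_l(z,·))^(U')` is a `d`-junta of `z`
      refine lowDeg_of_junta (hS l) (fun x x' hxx' => ?_) U hU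
      show coeff (fun y => T l x y) U' = coeff (fun y => T l x' y) U'
      congr 1
      funext y
      exact hrow y x x' hxx'
    · have : (fun z => coeff (fun y => T l z y) U') = fun _ => 0 := funext fun z => hcol l z hc
      rw [this]
      simp [coeff]
  rw [h1] at h2
  linarith [h2, mul_comm (coeff α U) (coeff β U')]

/-- **THE MIXED CELL IS EXCLUDED.** Under the hypotheses described in the file header, the XOR core admits no
identity `violCount(z + y) = ∑_l T_l(z, y) + α(z) β(y)` with non-negative one-sided `d`-junta terms and a positive
anchor, of any size. -/
theorem no_mixedJunta_anchor_core_of {A : V → Finset (Fin m)} {c : V → ZMod 2} {d : ℕ} (h : IsoHyp A 1 d)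
    (hA : ∀ v, (A v).card ≤ d) (hinj : Function.Injective A) (hdeg : bd A univ = ∅) (hodd : ∑ v, c v = 1)
    (hsurj : ∀ σ : V → ZMod 2, ∑ v, σ v = 0 → ∃ q : Fin m → ZMod 2, ∀ v, ∑ i ∈ A v, q i = σ v)
    (x : Finset V) (hx : 3 ≤ x.card) (hx' : x.card + 3 ≤ Fintype.card V)
    {L : Type} [Fintype L] (S : L → Finset (Fin m)) (hS : ∀ l, (S l).card ≤ d)
    (T : L → (Fin m → ZMod 2) → (Fin m → ZMod 2) → ℝ) (hT0 : ∀ l z y, 0 ≤ T l z y)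
    (hT : ∀ l, (∀ (y : Fin m → ZMod 2) (z z' : Fin m → ZMod 2),
                  (∀ i ∈ S l, z i = z' i) → T l z y = T l z' y) ∨
               (∀ (z : Fin m → ZMod 2) (y y' : Fin m → ZMod 2),
                  (∀ i ∈ S l, y i = y' i) → T l z y = T l z y'))
    (α β : (Fin m → ZMod 2) → ℝ) (hα : ∀ z, 0 < α z) (hβ : ∀ y, 0 < β y) :
    ¬ ∀ z y : Fin m → ZMod 2, violCount A c (z + y) = ∑ l, T l z y + α z * β y := by
  classical
  intro hid
  have hfar := h.far_bd x hx hx'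
  by_cases hβlow : ∀ U : Finset (Fin m), d < U.card → coeff β U = 0
  · -- `β` has degree `≤ d`
    obtain ⟨c₀, hsign, hstrict⟩ := h.exists_good_class hdeg c hA hinj hodd hsurj x hx hx' hβlow hβ
    exact mixed_anchor_core_contra_of h hA hfar c₀ S hS T hT0 hT α β hα hβlow hsign hstrict hid
  · -- otherwise `α` has degree `≤ d`: transpose
    push Not at hβlow
    obtain ⟨U', hU', hβU'⟩ := hβlow
    have hαlow : ∀ U : Finset (Fin m), d < U.card → coeff α U = 0 := fun U hU => by
      have := anchor_coeff_mul_eq_zero c hA S hS T hT α β hid hU hU'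
      rcases mul_eq_zero.mp this with h0 | h0
      · exact h0
      · exact absurd h0 hβU'
    obtain ⟨c₀, hsign, hstrict⟩ := h.exists_good_class hdeg c hA hinj hodd hsurj x hx hx' hαlow hα
    refine mixed_anchor_core_contra_of h hA hfar c₀ S hS (fun l y z => T l z y) (fun l y z => hT0 l z y)
      (fun l => (hT l).symm) β α hβ hαlow hsign hstrict fun y z => ?_
    rw [add_comm y z, hid z y, mul_comm (β y) (α z)]


/-- **THE MIXED CELL IS EXCLUDED on the Index-lift.** For a 3-XOR system `F` whose violation count is that of an
instance `(A, c)` as above and every `t ≥ 2`: no identity `viol_F(x[w]) = ∑_l T_l(x, w) + a(x) b(w)` with `T_l ≥ 0` each a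
block-`d`-junta of the table `x` OR a `d`-junta of the pointer `w`, and `a, b > 0` — of any size (restrict to the XOR core
`exists_xorCore` and apply `no_mixedJunta_anchor_core_of`). -/
theorem no_mixedJunta_anchor_lift_of {A : V → Finset (Fin m)} {c : V → ZMod 2} {d : ℕ} (h : IsoHyp A 1 d)
    (hA : ∀ v, (A v).card ≤ d) (hinj : Function.Injective A) (hdeg : bd A univ = ∅) (hodd : ∑ v, c v = 1)
    (hsurj : ∀ σ : V → ZMod 2, ∑ v, σ v = 0 → ∃ q : Fin m → ZMod 2, ∀ v, ∑ i ∈ A v, q i = σ v)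
    (x : Finset V) (hx : 3 ≤ x.card) (hx' : x.card + 3 ≤ Fintype.card V)
    (F : Finset (Pool m)) (hF : ∀ y : Fin m → ZMod 2, (viol F y : ℝ) = violCount A c y) {t : ℕ} (ht : 2 ≤ t)
    {L : Type} [Fintype L] (S : L → Finset (Fin m)) (hS : ∀ l, (S l).card ≤ d)
    (T : L → (Fin m → Fin t → ZMod 2) → (Fin m → Fin t) → ℝ) (hT0 : ∀ l x w, 0 ≤ T l x w)
    (hT : ∀ l, (∀ (w : Fin m → Fin t) (x x' : Fin m → Fin t → ZMod 2),
                  (∀ i ∈ S l, x i = x' i) → T l x w = T l x' w) ∨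
               (∀ (x : Fin m → Fin t → ZMod 2) (w w' : Fin m → Fin t),
                  (∀ i ∈ S l, w i = w' i) → T l x w = T l x w'))
    (a : (Fin m → Fin t → ZMod 2) → ℝ) (b : (Fin m → Fin t) → ℝ) (ha : ∀ x, 0 < a x) (hb : ∀ w, 0 < b w) :
    ¬ ∀ (x : Fin m → Fin t → ZMod 2) (w : Fin m → Fin t),
        (viol F (fun i => x i (w i)) : ℝ) = ∑ l, T l x w + a x * b w := by
  intro hfact
  obtain ⟨X, W, hread, hXc, hWc⟩ := exists_xorCore ht m
  refine no_mixedJunta_anchor_core_of h hA hinj hdeg hodd hsurj x hx hx' S hS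
    (fun l z y => T l (X z) (W y)) (fun l z y => hT0 l _ _) (fun l => ?_) (fun z => a (X z)) (fun y => b (W y))
    (fun z => ha _) (fun y => hb _) (fun z y => ?_)
  · rcases hT l with hrow | hcol
    · exact Or.inl fun y z z' hzz' => hrow (W y) _ _ fun i hi => hXc _ _ i (hzz' i hi)
    · exact Or.inr fun z y y' hyy' => hcol (X z) _ _ fun i hi => hWc _ _ i (hyy' i hi)
  · have hzy := hfact (X z) (W y)
    rw [hread z y, hF (z + y)] at hzy
    exact hzy

/-- **The mixed junta × anchor cell is excluded on the Index-lift** — registered sub-goal `no_mixedJunta_anchor_lift` of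
stmt-PneNP-10680, verbatim signature (see `no_mixedJunta_anchor_lift_of`). -/
theorem no_mixedJunta_anchor_lift :
    ∀ {m : ℕ} {V : Type} [Fintype V] [DecidableEq V] {A : V → Finset (Fin m)} {c : V → ZMod 2} {d : ℕ},
    IsoHyp A 1 d → (∀ v, (A v).card ≤ d) → Function.Injective A → bd A Finset.univ = ∅ → ∑ v, c v = 1 →
    (∀ σ : V → ZMod 2, ∑ v, σ v = 0 → ∃ q : Fin m → ZMod 2, ∀ v, ∑ i ∈ A v, q i = σ v) → ∀ (x : Finset
    V), 3 ≤ x.card → x.card + 3 ≤ Fintype.card V → ∀ (F : Finset (Pool m)), (∀ y : Fin m → ZMod 2, (viol F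
    y : ℝ) = violCount A c y) → ∀ {t : ℕ}, 2 ≤ t → ∀ {L : Type} [Fintype L] (S : L → Finset (Fin m)), (∀ l,
    (S l).card ≤ d) → ∀ (T : L → (Fin m → Fin t → ZMod 2) → (Fin m → Fin t) → ℝ), (∀ l x w, 0 ≤ T l x w)
    → (∀ l, (∀ (w : Fin m → Fin t) (x x' : Fin m → Fin t → ZMod 2), (∀ i ∈ S l, x i = x' i) → T l x w = T
    l x' w) ∨ (∀ (x : Fin m → Fin t → ZMod 2) (w w' : Fin m → Fin t), (∀ i ∈ S l, w i = w' i) → T l x w = T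
    l x w')) → ∀ (a : (Fin m → Fin t → ZMod 2) → ℝ) (b : (Fin m → Fin t) → ℝ), (∀ x, 0 < a x) → (∀ w, 0 <
    b w) → ¬ ∀ (x : Fin m → Fin t → ZMod 2) (w : Fin m → Fin t), (viol F (fun i => x i (w i)) : ℝ) = ∑ l, T
    l x w + a x * b w :=
  fun h hA hinj hdeg hodd hsurj x hx hx' F hF _ ht _ _ S hS T hT0 hT a b ha hb =>
    no_mixedJunta_anchor_lift_of h hA hinj hdeg hodd hsurj x hx hx' F hF ht S hS T hT0 hT a b ha hb

end

end Summit.PneNP.PneNP.Theorems.XorDoor.PC
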